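import Literature.Geometry.Symplectic.SphereCRFamily
import HarnessLib

/-!
# Members of the implicit-function family are honest small solutions on the discs of radius 3

Layer B7 (step 0') of the analytic core of the Hofer–Lizan–Sikorav local foliation theorem
(Wendl 2018, Thm. 2.46; lead of crux `WitnessCharge`, summit `SmoothPoincare4`). For a family
`γ : ball 0 ε → SecPair k r` with `γ 0 = 0`, continuous at `0`, small values and
`FT (γ a) = FN (γ a) = 0` (as produced by `SphereCRFamily.exists_family`), after shrinking `ε`
all four representatives of `γ a` are uniformly small on the discs of radius `4` (below the
invertibility threshold of the transports, `exists_pos_isUnit_PhiJet₀/₁`), and consequently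
`γ a` solves the chart Cauchy–Riemann equations `crExpr 𝒥.J₀ (𝒥.vmap₀ ξ⁰ f⁰) = 0` on `‖z‖ < 3` and
`crExpr 𝒥.J₁ (𝒥.vmap₁ ξ¹ f¹) = 0` on `‖w‖ < 3` (`exists_pos_forall_sol`). This is the input of
the regularity layers (`SphereCRSolutionLevels`, `SphereCRLinearRegularity`).

## References

* C. Wendl, *Holomorphic Curves in Low Dimensions*, LNM 2216 (2018), §2.3, Thm. 2.46. [Wendl2018]
-/

noncomputable section

open Set Filter Metric Function Complex
open scoped Topology NNReal ContDiff
open Literature.Analysis.FunctionSpaces Literature.Analysis.Complex.RiemannSphere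
open Literature.Analysis.Complex.ProjectiveLineExpChart Literature.Geometry.Symplectic.CRExpression
open Literature.Analysis.Complex Literature.Analysis.Calculus

namespace Literature.Geometry.Symplectic

namespace SphereCR

namespace SphereACData

variable (𝒥 : SphereACData) {r : ℝ≥0} {k : ℕ}

/-- A bound on the cut-off `z`-representative bounds the representative on `‖z‖ ≤ 4`.
[folklore] -/
theorem norm_sec₀_lt_of_cutSec₀CLM {τ : ℂ → ℂ} (hτ : ∀ w, w ≠ 0 → τ w ≠ 0)
    (hτs : ContDiffOn ℝ ∞ τ {w | w ≠ 0}) {j : ℕ} (hr : r ≤ 1)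
    (p : holderSections ℂ τ j r) {b : ℝ} (hb : ‖cutSec₀CLM hτ hτs hr p‖ < b) {z : ℂ} (hz : ‖z‖ ≤ 4) :
    ‖sec₀ τ p.1 z‖ < b := by
  have h := ContDiffHolderFunction.norm_apply_le_norm (cutSec₀CLM hτ hτs hr p) z
  rw [cutSec₀CLM_apply_of_norm_le _ _ hr p hz] at h
  exact h.trans_lt hb

/-- A bound on the cut-off `w`-representative bounds the representative on `‖w‖ ≤ 4`.
[folklore] -/
theorem norm_sec₁_lt_of_cutSec₁CLM {τ : ℂ → ℂ} (hτs : ContDiffOn ℝ ∞ τ {w | w ≠ 0})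
    {j : ℕ} (hr : r ≤ 1) (p : holderSections ℂ τ j r) {b : ℝ}
    (hb : ‖cutSec₁CLM hτs hr p‖ < b) {w : ℂ} (hw : ‖w‖ ≤ 4) : ‖sec₁ τ p.1 w‖ < b := by
  have h := ContDiffHolderFunction.norm_apply_le_norm (cutSec₁CLM hτs hr p) w
  rw [cutSec₁CLM_apply_of_norm_le _ hr p hw] at h
  exact h.trans_lt hb

/-- `‖T (γ a)‖ < b` for `a` near `0` when `γ` is continuous at `0` with `γ 0 = 0` and `T` is a
continuous linear map. [folklore] -/
theorem eventually_norm_comp_lt {X Y Z : Type*} [NormedAddCommGroup X] [NormedAddCommGroup Y]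
    [NormedSpace ℝ Y] [NormedAddCommGroup Z] [NormedSpace ℝ Z] {γ : X → Y} (hγ : ContinuousAt γ 0)
    (hγ0 : γ 0 = 0) (T : Y →L[ℝ] Z) {b : ℝ} (hb : 0 < b) : ∀ᶠ a in 𝓝 (0 : X), ‖T (γ a)‖ < b := by
  have hc : ContinuousAt (fun a => ‖T (γ a)‖) 0 :=
    (T.continuous.continuousAt.comp (by simpa [hγ0] using hγ)).norm
  have h0 : ‖T (γ 0)‖ < b := by simp [hγ0, hb]
  exact (hc.eventually (gt_mem_nhds h0)).mono fun a ha => by simpa using ha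

/-- **Members of the family are uniformly small honest solutions.** For `γ : ℂ → SecPair k r`
with `γ 0 = 0`, continuous at `0`, and for `‖a‖ < ε`: `γ a` small with `FT (γ a) = FN (γ a) = 0`,
there are `ε' ∈ (0, ε]` and `δ > 0` such that the transports `PhiJet₀ z c t`, `PhiJet₁ w c t` are
invertible (and `den ≠ 0`) for `‖·‖ ≤ 3`, `‖c‖, ‖t‖ < δ`, and for every `‖a‖ < ε'`: all four
representatives of `γ a` have modulus `< δ` on the discs of radius `4`, and `γ a` solves
`crOp₀ = 0`, `crExpr J₀ (vmap₀ ξ⁰ f⁰) = 0` on `‖z‖ < 3` and `crOp₁ = 0`, `crExpr J₁ (vmap₁ ξ¹ f¹) = 0`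
on `‖w‖ < 3`. [cite: Wendl2018, Thm. 2.46] -/
theorem exists_pos_forall_sol (hr1 : r < 1) {ε : ℝ} (hε : 0 < ε) (γ : ℂ → SecPair k r)
    (hγ0 : γ 0 = 0) (hγc : ContinuousAt γ 0)
    (hsmall : ∀ a ∈ ball (0 : ℂ) ε, Small hr1.le k (γ a))
    (hsol : ∀ a ∈ ball (0 : ℂ) ε, 𝒥.FT hr1.le k (γ a) = 0 ∧ 𝒥.FN hr1.le k (γ a) = 0) :
    ∃ ε' > (0 : ℝ), ε' ≤ ε ∧ ∃ δ > (0 : ℝ),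
      (∀ z c t : ℂ, ‖z‖ ≤ 3 → ‖c‖ < δ → ‖t‖ < δ → den z c ≠ 0 ∧ IsUnit (𝒥.PhiJet₀ z c t)) ∧
      (∀ w c t : ℂ, ‖w‖ ≤ 3 → ‖c‖ < δ → ‖t‖ < δ → den w c ≠ 0 ∧ IsUnit (𝒥.PhiJet₁ w c t)) ∧
      ∀ a ∈ ball (0 : ℂ) ε',
        (∀ z : ℂ, ‖z‖ ≤ 4 →
          ‖sec₀ (fun w : ℂ => -w ^ 2) (γ a).1.1 z‖ < δ ∧ ‖sec₀ (1 : ℂ → ℂ) (γ a).2.1 z‖ < δ ∧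
          ‖sec₁ (fun w : ℂ => -w ^ 2) (γ a).1.1 z‖ < δ ∧ ‖sec₁ (1 : ℂ → ℂ) (γ a).2.1 z‖ < δ) ∧
        (∀ z : ℂ, ‖z‖ < 3 →
          𝒥.crOp₀ (sec₀ (fun w : ℂ => -w ^ 2) (γ a).1.1) (sec₀ (1 : ℂ → ℂ) (γ a).2.1) z = 0 ∧
          crExpr 𝒥.J₀ (𝒥.vmap₀ (sec₀ (fun w : ℂ => -w ^ 2) (γ a).1.1)
            (sec₀ (1 : ℂ → ℂ) (γ a).2.1)) z = 0) ∧
        (∀ w : ℂ, ‖w‖ < 3 →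
          𝒥.crOp₁ (sec₁ (fun w : ℂ => -w ^ 2) (γ a).1.1) (sec₁ (1 : ℂ → ℂ) (γ a).2.1) w = 0 ∧
          crExpr 𝒥.J₁ (𝒥.vmap₁ (sec₁ (fun w : ℂ => -w ^ 2) (γ a).1.1)
            (sec₁ (1 : ℂ → ℂ) (γ a).2.1)) w = 0) := by
  obtain ⟨δ₀, hδ₀, hU₀⟩ := 𝒥.exists_pos_isUnit_PhiJet₀
  obtain ⟨δ₁, hδ₁, hU₁⟩ := 𝒥.exists_pos_isUnit_PhiJet₁
  set δm : ℝ := min δ₀ δ₁ with hδm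
  have hδm0 : 0 < δm := lt_min hδ₀ hδ₁
  have hUm₀ : ∀ z c t : ℂ, ‖z‖ ≤ 3 → ‖c‖ < δm → ‖t‖ < δm →
      den z c ≠ 0 ∧ IsUnit (𝒥.PhiJet₀ z c t) := fun z c t hz hc ht =>
    hU₀ z c t hz (hc.trans_le (min_le_left _ _)) (ht.trans_le (min_le_left _ _))
  have hUm₁ : ∀ w c t : ℂ, ‖w‖ ≤ 3 → ‖c‖ < δm → ‖t‖ < δm →
      den w c ≠ 0 ∧ IsUnit (𝒥.PhiJet₁ w c t) := fun w c t hw hc ht =>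
    hU₁ w c t hw (hc.trans_le (min_le_right _ _)) (ht.trans_le (min_le_right _ _))
  -- shrink `ε`
  have hTξ := eventually_norm_comp_lt hγc hγ0
    ((cutSec₀CLM neg_sq_clutch_ne_zero contDiffOn_neg_sq_clutch hr1.le).comp
      (ContinuousLinearMap.fst ℝ _ (holderSections ℂ (1 : ℂ → ℂ) (k + 1) r))) hδm0
  have hTξ' := eventually_norm_comp_lt hγc hγ0
    ((cutSec₁CLM (τ := fun w : ℂ => -w ^ 2) contDiffOn_neg_sq_clutch hr1.le).comp
      (ContinuousLinearMap.fst ℝ _ (holderSections ℂ (1 : ℂ → ℂ) (k + 1) r))) hδm0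
  have hTf := eventually_norm_comp_lt hγc hγ0
    ((cutSec₀CLM one_clutch_ne_zero contDiffOn_one_clutch hr1.le).comp
      (ContinuousLinearMap.snd ℝ (holderSections ℂ (fun w : ℂ => -w ^ 2) (k + 1) r) _)) hδm0
  have hTf' := eventually_norm_comp_lt hγc hγ0
    ((cutSec₁CLM (τ := (1 : ℂ → ℂ)) contDiffOn_one_clutch hr1.le).comp
      (ContinuousLinearMap.snd ℝ (holderSections ℂ (fun w : ℂ => -w ^ 2) (k + 1) r) _)) hδm0
  obtain ⟨ε₁, hε₁, hball⟩ := Metric.eventually_nhds_iff_ball.1 ((hTξ.and hTξ').and (hTf.and hTf'))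
  refine ⟨min ε ε₁, lt_min hε hε₁, min_le_left _ _, δm, hδm0, hUm₀, hUm₁, fun a ha => ?_⟩
  have haε : a ∈ ball (0 : ℂ) ε := ball_subset_ball (min_le_left _ _) ha
  have ha₁ : a ∈ ball (0 : ℂ) ε₁ := ball_subset_ball (min_le_right _ _) ha
  have hsm := hsmall a haε
  obtain ⟨hT, hN⟩ := hsol a haε
  obtain ⟨h0, h1⟩ := 𝒥.out_eq_zero_of_FT_FN hsm hT hN
  obtain ⟨⟨hbξ, hbξ'⟩, ⟨hbf, hbf'⟩⟩ := hball a ha₁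
  simp only [ContinuousLinearMap.coe_comp, Function.comp_apply, ContinuousLinearMap.coe_fst',
    ContinuousLinearMap.coe_snd'] at hbξ hbξ' hbf hbf'
  have hbounds : ∀ z : ℂ, ‖z‖ ≤ 4 →
      ‖sec₀ (fun w : ℂ => -w ^ 2) (γ a).1.1 z‖ < δm ∧ ‖sec₀ (1 : ℂ → ℂ) (γ a).2.1 z‖ < δm ∧
      ‖sec₁ (fun w : ℂ => -w ^ 2) (γ a).1.1 z‖ < δm ∧ ‖sec₁ (1 : ℂ → ℂ) (γ a).2.1 z‖ < δm :=
    fun z hz => ⟨norm_sec₀_lt_of_cutSec₀CLM _ _ hr1.le _ hbξ hz,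
      norm_sec₀_lt_of_cutSec₀CLM _ _ hr1.le _ hbf hz, norm_sec₁_lt_of_cutSec₁CLM _ hr1.le _ hbξ' hz,
      norm_sec₁_lt_of_cutSec₁CLM _ hr1.le _ hbf' hz⟩
  refine ⟨hbounds, fun z hz => ?_, fun w hw => ?_⟩
  · have hz3 : ‖z‖ ≤ 3 := hz.le
    obtain ⟨b1, b2, -, -⟩ := hbounds z (hz3.trans (by norm_num))
    have hc := 𝒥.crOp₀_eq_zero_of_out₀ hsm h0 hz
    exact ⟨hc, 𝒥.crExpr_eq_zero_of_crOp₀ hUm₀ hz3 b1 b2 hc⟩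
  · have hw3 : ‖w‖ ≤ 3 := hw.le
    obtain ⟨-, -, b3, b4⟩ := hbounds w (hw3.trans (by norm_num))
    have hc := 𝒥.crOp₁_eq_zero_of_out₁ hsm h1 hw
    exact ⟨hc, 𝒥.crExpr_eq_zero_of_crOp₁ hUm₁ hw3 b3 b4 hc⟩

end SphereACData

end SphereCR

end Literature.Geometry.Symplectic

end
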